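/-
COR-CM (cell pub-hodgecm2, stage 2 of the Hodge ladder) — count-neutral KERNEL COMBINATORICS «the sheared dihedral family», part XXI: generation by
block faces and ten closers in the slice column (seat prover-pub-hodgecm2-b23-g52-0, binder prover b23, gen 52; claim «SYLOW TRANSFER XII + THE
SHEARED DIHEDRAL FAMILY», HOME/INBOX.md l.23708).  PORT of gen 45ʼs `Census/QuarticInversionGeneration.lean` (this lineage) to the involution `s`
at square class `0`: bookkeeping definitions with bodies (`repS`, `blockFaceS`, `blockFacesS`, `familyS`) + theorems, on parts X/XII/XV/XVI/XX and
gen 44/45ʼs parts VI/VIII/XIII/XXI (`redSet`, `killed_of_mem`, `cover_translH₄`, `cover_translY`, `descent_of_cover`, `mem_pairs₄_of_killed`)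
BY NAME; no `decide` beyond `Fin 4` literals, no certificate, no named fact, no geometry, no `sorry`.  `Interfaces.lean` (C1), every E term,
B01, `Transposition/*`, `PortJoin/*`, `D2Bridge/*` untouched.
HONEST FRAMING: `HC_CM` is NOT proved, here or anywhere in the tree; nothing here is a period, a count of record or a headline.
-/
import Summits.HodgeConjecture.CorCM.Census.ShearedDihedralLattice
import Summits.HodgeConjecture.CorCM.Census.ShearedDihedralResidualBlocks
import Summits.HodgeConjecture.CorCM.Census.ShearedDihedralDescent
import Summits.HodgeConjecture.CorCM.Census.QuarticInversionGeneration

/-!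
# The sheared dihedral family, XXI: generation in the slice column — `hodge₄ ≤ pairs₄ ⊔ orbSpanS (block faces ∪ B1)`

CONTENT (`|A|` odd `≥ 3`, square class `0`, slot datum, cross datum).
* §1 The span of gen 45ʼs reducing faces `redSet` is stable under `s` too (`translS_mem_span_redSet`), so the `s`-orbit span of any set of
  reducing faces is killed by the functionals.
* §2 **Block faces**: one reducing face through a representative of every non-residual `s`-block (`blockFacesS`); their `s`-orbit span covers
  every non-residual label (`blockFacesS_cover`).
* §3 **GENERATION** (`hodge₄_leS`): `hodge₄ ≤ pairs₄ ⊔ orbSpanS 0 (blockFacesS ∪ B1)` — descent by the cover down to potential `≤ 1`, the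
  remainder killed by all functionals (part XX puts `Avec x` in the value module of `B1`), hence a pair sum by gen 44ʼs key lemma.
* §4 **The count**: `#familyS + 2 ≤ #BlockS` (twelve residual blocks, part XVI), and the family consists of model faces.  All [folklore].

## References
* [Pohlmann1968] H. Pohlmann, Algebraic cycles on abelian varieties of complex multiplication type, Ann. of Math. 88 (1968), Thm 1.
-/

namespace Summit.HodgeConjecture.CorCM.Census.ShearedDihedral

open Summit.HodgeConjecture.CorCM.Census.QuarticInversion
open Finset
open Summit.HodgeConjecture.CorCM.Census.OddSliceFacesModel

noncomputable section

variable (A : Type) [AddCommGroup A] [Fintype A] [DecidableEq A]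

/-! ## §1 Reducing faces move with `s` -/

/-- The span of the reducing faces is stable under `s`. [folklore] -/
theorem translS_mem_span_redSet (hA : Odd (Fintype.card A)) {v : Ty₄ A → ℤ} (hv : v ∈ Submodule.span ℤ (redSet A)) :
    translS A v ∈ Submodule.span ℤ (redSet A) := by
  have hle : (Submodule.span ℤ (redSet A)).map (translSHom A) ≤ Submodule.span ℤ (redSet A) := by
    rw [Submodule.map_span]
    refine Submodule.span_mono ?_
    rintro _ ⟨u, ⟨Θ, p, q, h, rfl⟩, rfl⟩
    exact ⟨twS A Θ, plT A p, plT A q, reducing_twS A hA h, by rw [translSHom_apply, translS_faceVec₄]⟩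
  exact hle (Submodule.mem_map_of_mem (f := translSHom A) hv)

/-! ## §2 The block faces and their covering property -/

/-- A label in each `s`-block (a choice). [folklore] -/
def repS (B : BlockS A) : Ty₄ A := Quotient.out B

omit [Fintype A] [DecidableEq A] in
/-- `repS B` lies in `B`. [folklore] -/
theorem blkS_repS (B : BlockS A) : blkS A (repS A B) = B := Quotient.out_eq B

omit [DecidableEq A] in
/-- The potential of the representative is the potential of the block. [folklore] -/
theorem pot₄_repS (B : BlockS A) : pot₄ A (repS A B) = potBS A B := by
  rw [← potBS_blkS A, blkS_repS]

/-- **The block face**: gen 44ʼs reducing face through the representative (junk `0` for residual blocks). [folklore] -/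
def blockFaceS (B : BlockS A) : Ty₄ A → ℤ :=
  if h : 2 ≤ pot₄ A (repS A B) then
    faceVec₄ A (repS A B) (Classical.choose (exists_reducing A h)) (Classical.choose (Classical.choose_spec (exists_reducing A h)))
  else 0

/-- The block face of a non-residual block is a reducing face through its representative. [folklore] -/
theorem blockFaceS_spec {B : BlockS A} (hB : 2 ≤ potBS A B) :
    ∃ p q, (p ≠ q ∧ ∀ c, pot₄ A (corner A (repS A B) p q c) < pot₄ A (repS A B) ∧
      ∀ n, half A (coord A n (corner A (repS A B) p q c)) = half A (coord A n (repS A B))) ∧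
      blockFaceS A B = faceVec₄ A (repS A B) p q := by
  have h : 2 ≤ pot₄ A (repS A B) := by rw [pot₄_repS]; exact hB
  refine ⟨_, _, Classical.choose_spec (Classical.choose_spec (exists_reducing A h)), ?_⟩
  rw [blockFaceS, dif_pos h]

/-- **The block faces**: one per non-residual `s`-block. [folklore] -/
def blockFacesS : Finset (Ty₄ A → ℤ) := (univ.filter fun B : BlockS A => 2 ≤ potBS A B).image (blockFaceS A)

/-- Block faces are reducing faces. [folklore] -/
theorem blockFacesS_subset_redSet : (↑(blockFacesS A) : Set (Ty₄ A → ℤ)) ⊆ redSet A := by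
  intro v hv
  obtain ⟨B, hB, rfl⟩ := Finset.mem_image.mp (Finset.mem_coe.mp hv)
  obtain ⟨p, q, h, e⟩ := blockFaceS_spec A (Finset.mem_filter.mp hB).2
  exact ⟨_, p, q, h, e⟩

/-- Block faces are Hodge vectors. [folklore] -/
theorem blockFacesS_subset_hodge₄ : (↑(blockFacesS A) : Set (Ty₄ A → ℤ)) ⊆ hodge₄ A := by
  intro v hv
  obtain ⟨Θ, p, q, h, rfl⟩ := blockFacesS_subset_redSet A hv
  exact faceVec₄_mem A Θ h.1

/-- There are at most as many block faces as non-residual blocks. [folklore] -/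
theorem card_blockFacesS_le : (blockFacesS A).card ≤ (univ.filter fun B : BlockS A => 2 ≤ potBS A B).card :=
  Finset.card_image_le

/-- The `s`-orbit span of the block faces lies in the span of all reducing faces. [folklore] -/
theorem orbSpanS_blockFacesS_le (hA : Odd (Fintype.card A)) : orbSpanS A 0 ↑(blockFacesS A) ≤ Submodule.span ℤ (redSet A) :=
  orbSpanS_le A 0 (fun _ hv => Submodule.subset_span (blockFacesS_subset_redSet A hv))
    (fun g _ hv => translH₄_mem_span_redSet A hA g hv) (fun _ hv => translY_mem_span_redSet A 0 hA hv)
    (fun _ hv => translS_mem_span_redSet A hA hv)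

omit [DecidableEq A] in
/-- A covering vector moves with `s`. [folklore] -/
theorem cover_translS {v : Ty₄ A → ℤ} {Θ : Ty₄ A} (hv : v Θ = 1 ∧ ∀ χ, χ ≠ Θ → v χ ≠ 0 → pot₄ A χ < pot₄ A Θ) :
    translS A v (twS A Θ) = 1 ∧ ∀ χ, χ ≠ twS A Θ → translS A v χ ≠ 0 → pot₄ A χ < pot₄ A (twS A Θ) := by
  have e : ∀ χ, translS A v χ = v (twS A χ) := fun χ => rfl
  refine ⟨by rw [e, twS_twS]; exact hv.1, fun χ hχ hne => ?_⟩
  rw [e] at hne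
  have hχ' : twS A χ ≠ Θ := fun h => hχ (by rw [← h, twS_twS])
  have := hv.2 _ hχ' hne
  rwa [pot₄_twS, ← pot₄_twS A Θ] at this

omit [DecidableEq A] in
/-- **Covers move along chains of motions** inside an `s`-orbit span. [folklore] -/
theorem cover_of_reachS (F : Set (Ty₄ A → ℤ)) {Θ Θ' : Ty₄ A}
    (hreach : Relation.ReflTransGen
      (fun Θ₁ Θ₂ : Ty₄ A => (∃ g : ZMod 2 × A, Θ₂ = twH₄ A g Θ₁) ∨ Θ₂ = twY A 0 Θ₁ ∨ Θ₂ = twS A Θ₁) Θ Θ')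
    (hcov : ∃ v ∈ orbSpanS A 0 F, v Θ = 1 ∧ ∀ χ, χ ≠ Θ → v χ ≠ 0 → pot₄ A χ < pot₄ A Θ) :
    ∃ v ∈ orbSpanS A 0 F, v Θ' = 1 ∧ ∀ χ, χ ≠ Θ' → v χ ≠ 0 → pot₄ A χ < pot₄ A Θ' := by
  induction hreach with
  | refl => exact hcov
  | tail _ hs ih =>
    obtain ⟨v, hvF, hv⟩ := ih
    rcases hs with ⟨g, rfl⟩ | rfl | rfl
    · exact ⟨_, translH₄_mem_orbSpanS A 0 F g hvF, cover_translH₄ A g hv⟩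
    · exact ⟨_, translY_mem_orbSpanS A 0 F hvF, cover_translY A 0 hv⟩
    · exact ⟨_, translS_mem_orbSpanS A 0 F hvF, cover_translS A hv⟩

/-- **The `s`-orbit span of the block faces covers every non-residual label.** [folklore] -/
theorem blockFacesS_cover (Ψ : Ty₄ A) (hΨ : 2 ≤ pot₄ A Ψ) :
    ∃ v ∈ orbSpanS A 0 ↑(blockFacesS A), v Ψ = 1 ∧ ∀ χ, χ ≠ Ψ → v χ ≠ 0 → pot₄ A χ < pot₄ A Ψ := by
  set B := blkS A Ψ with hBdef
  have hB : 2 ≤ potBS A B := by rw [hBdef, potBS_blkS]; exact hΨ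
  have hreach := (blkS_eq_blkS_iff A (repS A B) Ψ).mp (blkS_repS A B)
  obtain ⟨p, q, h, e⟩ := blockFaceS_spec A hB
  refine cover_of_reachS A _ hreach ⟨blockFaceS A B, subset_orbSpanS A 0 _ ?_, ?_⟩
  · exact Finset.mem_coe.mpr (Finset.mem_image_of_mem _ (Finset.mem_filter.mpr ⟨Finset.mem_univ _, hB⟩))
  · rw [e]; exact faceVec₄_reducing A fun c => (h.2 c).1

/-! ## §3 Generation -/

omit [Fintype A] [DecidableEq A] in
/-- `s`-orbit spans are monotone in the family. [folklore] -/
theorem orbSpanS_mono (ζ : ZMod 2) {F F' : Set (Ty₄ A → ℤ)} (h : F ⊆ F') : orbSpanS A ζ F ≤ orbSpanS A ζ F' :=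
  orbSpanS_le A ζ (fun _ hf => subset_orbSpanS A ζ F' (h hf)) (fun g _ hv => translH₄_mem_orbSpanS A ζ F' g hv)
    (fun _ hv => translY_mem_orbSpanS A ζ F' hv) (fun _ hv => translS_mem_orbSpanS A ζ F' hv)

/-- **The generating family of the slice column**: the block faces and the ten closing faces. [folklore] -/
def familyS (P : Finset A) (u₁ u₂ : A) (Q : Finset A) (w u₀ : A) : Finset (Ty₄ A → ℤ) :=
  blockFacesS A ∪ famB1S A P u₁ u₂ Q w u₀

section Gen
variable {P : Finset A} {u₁ u₂ : A} {Q : Finset A} {w u₀ σ s₀ : A}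

/-- **GENERATION: `hodge₄ ≤ pairs₄ ⊔ orbSpanS 0 (blockFacesS ∪ B1)`** (`|A|` odd `≥ 3`, slot datum, cross datum). [folklore] -/
theorem hodge₄_leS (hA : Odd (Fintype.card A)) (h3 : 3 ≤ Fintype.card A) (h1 : u₁ ∉ P) (h2 : u₂ ∉ P) (h12 : u₁ ≠ u₂)
    (hP : P.card + 1 = Fintype.card A / 2) (hs₀ : s₀ ∈ insert u₁ (insert u₂ P))
    (hX : ∀ s, s + σ ∈ insert u₁ (insert u₂ P) ↔ (s ∉ insert u₁ (insert u₂ P) ∨ s = s₀)) (hw : w ∉ Q)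
    (hQ : Q.card = Fintype.card A / 2) :
    hodge₄ A ≤ pairs₄ A ⊔ orbSpanS A 0 ↑(familyS A P u₁ u₂ Q w u₀) := by
  intro x hx
  obtain ⟨c, hc, hAc⟩ := Submodule.mem_map.mp (Avec_mem_valModS_of_hodge A hA h3 h1 h2 h12 hP hs₀ hX hw hQ (u₀ := u₀) hx)
  have hcH : c ∈ hodge₄ A := orbSpanS_le_hodge₄ A 0 (famB1S_subset_hodge₄ A (P := P) (Q := Q) (w := w) (u₀ := u₀) h12) hc
  obtain ⟨r, hres, hmem⟩ := descent_of_cover (pot₄ A) (orbSpanS A 0 ↑(blockFacesS A)) (blockFacesS_cover A)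
    (4 * Fintype.card A) (x - c) (fun χ _ => pot₄_le A χ)
  have hkill := killed_of_mem A hA (Submodule.mem_sup_right (orbSpanS_blockFacesS_le A hA hmem))
  have hval : ∀ w', (fnl A w' x = fnl A w' c) → fnl A w' (x - c - r) = 0 → fnl A w' r = 0 := by
    intro w' h h'
    rw [map_sub, map_sub, h, sub_self, zero_sub, neg_eq_zero] at h'
    exact h'
  have hkA : ∀ j η u, fnl A (wA A j η u) r = 0 := fun j η u =>
    hval _ (by have := congrFun hAc (Sum.inl (j, η, u)); simpa using this.symm) (hkill.1 j η u)
  have hkC : ∀ η, fnl A (wC A η) r = 0 := fun η =>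
    hval _ (by have := congrFun hAc (Sum.inr η); simpa using this.symm) (hkill.2 η)
  have hr : r ∈ pairs₄ A := mem_pairs₄_of_killed A hA h3 hres hkA hkC
  have e : x = c + (x - c - r) + r := by abel
  rw [e]
  refine Submodule.add_mem _ (Submodule.add_mem _ (Submodule.mem_sup_right ?_) (Submodule.mem_sup_right ?_))
    (Submodule.mem_sup_left hr)
  · exact orbSpanS_mono A 0 (by simp [familyS]) hc
  · exact orbSpanS_mono A 0 (by simp [familyS]) hmem

/-! ## §4 The count -/

/-- **`#familyS + 2 ≤ #BlockS`** (`|A|` odd `≥ 3`: twelve residual blocks carry no block face). [folklore] -/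
theorem card_familyS_add_two_le (hA : Odd (Fintype.card A)) (h2 : 2 ≤ Fintype.card A) :
    (familyS A P u₁ u₂ Q w u₀).card + 2 ≤ Fintype.card (BlockS A) := by
  have hu := Finset.card_union_le (blockFacesS A) (famB1S A P u₁ u₂ Q w u₀)
  have hb := card_blockFacesS_le A
  have hf := card_famB1S_le A P u₁ u₂ Q w u₀
  have htw := twelve_le_card_residualS A hA h2
  have hpart := Finset.card_filter_add_card_filter_not (s := (univ : Finset (BlockS A))) (fun B => potBS A B ≤ 1)
  have hneg : (univ.filter fun B : BlockS A => ¬ potBS A B ≤ 1) = univ.filter fun B : BlockS A => 2 ≤ potBS A B := by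
    refine Finset.filter_congr fun B _ => ?_; omega
  rw [hneg, Finset.card_univ] at hpart
  unfold familyS
  omega

/-- The family consists of faces of the model: `faceVec₄ Θ p q` with `p ≠ q`. [folklore] -/
theorem familyS_shape (h12 : u₁ ≠ u₂) {f : Ty₄ A → ℤ} (hf : f ∈ familyS A P u₁ u₂ Q w u₀) :
    ∃ Θ p q, p ≠ q ∧ f = faceVec₄ A Θ p q := by
  rcases Finset.mem_union.mp hf with hf | hf
  · obtain ⟨Θ, p, q, h, e⟩ := blockFacesS_subset_redSet A (Finset.mem_coe.mpr hf)
    exact ⟨Θ, p, q, h.1, e⟩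
  · obtain ⟨k, -, rfl⟩ := Finset.mem_image.mp hf
    have hne : ((0 : Fin 4), u₁) ≠ ((0 : Fin 4), u₂) := fun e => h12 (Prod.mk.inj e).2
    have hne1 : ∀ u u' : A, ((0 : Fin 4), u) ≠ ((1 : Fin 4), u') := fun u u' e => absurd (Prod.mk.inj e).1 (by decide)
    have hne2 : ∀ u u' : A, ((0 : Fin 4), u) ≠ ((2 : Fin 4), u') := fun u u' e => absurd (Prod.mk.inj e).1 (by decide)
    fin_cases k
    · exact ⟨_, _, _, hne, rfl⟩
    · exact ⟨_, _, _, hne, rfl⟩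
    · exact ⟨_, _, _, hne, rfl⟩
    · exact ⟨_, _, _, hne, rfl⟩
    · exact ⟨_, _, _, hne, rfl⟩
    · exact ⟨_, _, _, hne1 _ _, rfl⟩
    · exact ⟨_, _, _, hne2 _ _, rfl⟩
    · exact ⟨_, _, _, hne1 _ _, rfl⟩
    · exact ⟨_, _, _, hne1 _ _, rfl⟩
    · exact ⟨_, _, _, hne1 _ _, rfl⟩

end Gen

end

end Summit.HodgeConjecture.CorCM.Census.ShearedDihedral
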